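import Literature.Barriers.NavierStokesRegularity.NavierStokesInequalitySwitching
import Literature.Analysis.FluidPDE.MeridianReduction
import HarnessLib

/-!
# Scheffer's block, decomposed: structures and the geometric arrangement (Ożański 2017, §§3–5)

Barrier catalogue support file for `NavierStokesRegularity` (D-0021), the layer under
`NavierStokesInequalitySwitching`, which reduced Scheffer's singular weak solution of the
Navier–Stokes inequality (`NavierStokesInequalitySingularSolution`) to the switching principle
(fact A) and `NSIBlockExists` (fact B, a classical block `IsNSIBlock`). Fact B is decomposed here
along its printed proof in W. S. Ożański, arXiv:1709.00602, §4 (opening): "we define constants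
`T > 0`, `ν₀ > 0`, `τ ∈ (0,1)`, `z ∈ ℝ³`, the set `G` and the vector field `u` which were required
in the sketch proof in Section 2. The definition is based on … the geometric arrangement" —
given the arrangement (§4, before (4.12)) one obtains `ν₀` and `u`; the arrangement itself is
constructed in §5. In Scheffer's original: "Theorem 1.1 is a consequence of Lemma 6.4, Lemma
3.3 and Lemma 2.4" (p. 84) — §3 (Lemmas 3.1–3.3, the basic construction under the hypotheses
(3.1)–(3.7) = the arrangement) and §§4–6 (Lemmas 4.1–4.8, 5.1–5.5, 6.1–6.4).

## What is printed (Ożański 2017) and how it is rendered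

* §3.1–3.3: `P = {(x₁,x₂) : x₂ > 0}` (axial coordinate, distance to the axis), `R(U) ⊆ ℝ³` the
  solid of revolution of `U ⋐ P` (3.2), `R⁻¹` the cylindrical projection (3.3); for planar `v`
  and `f ≥ |v|` the axisymmetric field `u[v,f] = v₁ x̂₁ + v₂ ρ̂ + √(f² - |v|²) φ̂` ((3.10)/(3.12),
  `|u[v,f]| = f` (3.11)), its pressure function `p*[v,f]` ((3.19), the pressure (1.1)
  `= -Δ⁻¹∂ᵢ∂ⱼ(uᵢuⱼ)` of `u[v,f]`), `p[v,f](x₁,x₂) = p*[v,f](x₁,x₂,0)` (3.20),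
  `Lf = Δf + x₂⁻¹∂₂f - x₂⁻²f` (3.15), `F[v,f] = ∇p[0,f] - ∇p[v,f]` (3.34).
  The tree's axisymmetric vocabulary (`FluidPDE/AxisymmetricEuler`, `MeridianReduction`) has the
  axis `x 2`: Ożański's `Ox₁` is our `x 2`-axis, his plane point `(x₁,x₂)` = (axial, radial) is
  our `q = (r, z) ∈ ℝ × ℝ` (radial, axial), `(x̂₁, ρ̂, φ̂) = (eZ, eR, eTheta)`, `R⁻¹ = meridian`,
  `R(U) = meridian ⁻¹' U =: revolve U`, his plane `{x₃ = 0}` is `meridianPoint (r,z) = (r,0,z)`,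
  a planar `v = (v_r, v_z)` is his `(v₂, v₁)`; `ℝ × ℝ` carries the sup norm, so Euclidean lengths
  are written out and planar derivatives are the Fréchet partials `derivR`, `derivZ`. The
  pressure is the tree's `normalisedPressure` (`-Δ⁻¹∂ᵢ∂ⱼ(uᵢuⱼ)` as a principal value) = (1.1).
* Definition 3.3 (§3.4) — `IsNSIStructure U v f φ`: `v ∈ C_c^∞(U;ℝ²)`, `f ∈ C_c^∞(P;[0,∞))`,
  `φ ∈ C_c^∞(U;[0,1])`, `supp f = Ū`, `supp v ⊆ {φ = 1}`, `div(x₂ v) = 0` in `U`, `f > |v|` in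
  `U`, `Lf > 0` in `U ∖ {φ = 1}`.
* §4 (4.1)–(4.3) — `IsNSIArrangement`: `U₁, U₂ ⋐ P` with structures, `Ū₁ ∩ Ū₂ = ∅`,
  `T > 0`, `τ ∈ (0,1)`, `z` with `f₂² + T v₂·F[v₁,f₁] > |v₂|²` in `U₂` (4.1) and
  `f₂(y)² + T v₂(y)·F[v₁,f₁](y) > τ⁻²(f₁(R⁻¹x) + f₂(R⁻¹x))²` for `x ∈ G := R(Ū₁ ∪ Ū₂)`,
  `y = R⁻¹(τx + z)` (4.2)–(4.3). We add `U₁ ≠ ∅` explicitly (true in print, `U₁ ⊇ U =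
  (-1,1) × (1/8,7/8)`; the empty pair with zero data satisfies (4.1)–(4.2) vacuously).
* Fact C `NSIArrangementExists` — §5. Fact D `NSIBlock_of_arrangement` — §4 (Lemma 4.1, (4.21),
  Prop. 4.2 and the paragraph after it). PROVED: `|u[v,f]| = f` (3.11), `u[v,f]` on the meridian
  plane (3.10), `G` compact, `Γ(G) ⊆ R(Ū₂) ⊆ G` from (4.2) ((4.4), §5.4), `C → D → NSIBlockExists`.

Deliberately NOT here: the proofs of C and D (Lemmas 3.1, 3.2, 3.5, 4.1, 5.2, 5.3, Thms. 3.4,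
4.3, Prop. 4.2, App. A of Ożański 2017 — the next layers). Numbering is that of the arXiv v4
PDF/LaTeX source (theorems numbered within sections); the held plain-text rendering numbers
theorems globally: its Lemma 3, 4, Def. 5, Thm. 6, Lemma 7, 8, Prop. 9, Thm. 10, Lemma 12, 13 are
Lemma 3.1, 3.2, Def. 3.3, Thm. 3.4, Lemma 3.5, 4.1, Prop. 4.2, Thm. 4.3, Lemma 5.2, 5.3 here.

## References

* W. S. Ożański, arXiv:1709.00602v4 (2017/2019), §3 (Def. 3.3, (3.2)–(3.34), Lemmas 3.1, 3.2,
  3.5, Thm. 3.4), §4 ((4.1)–(4.4), Lemma 4.1, (4.21), Prop. 4.2, Thm. 4.3), §5 (Lemmas 5.2, 5.3).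
  [`Ozanski2017NSISingular`]
* V. Scheffer, Comm. Math. Phys. 101 (1985), 47–85: p. 51 (`u[v,f]`, `p*[v,f]`, `L`), Lemmas 2.1,
  3.1–3.3, §4, §6 (Lemmas 6.2–6.4, p. 84). [`Scheffer1985`]
-/

noncomputable section

open MeasureTheory Set Function Filter Topology TopologicalSpace WithLp Metric
open scoped ENNReal InnerProductSpace RealInnerProductSpace ContDiff

namespace Literature.Barriers.NavierStokesRegularity

open Literature.Analysis.FluidPDE

/-- Local notation for physical space `ℝ³ = EuclideanSpace ℝ (Fin 3)`. -/
local notation "ℝ³" => EuclideanSpace ℝ (Fin 3)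

/-! ### The meridian half-plane and solids of revolution -/

/-- The open **half-plane** `P` of meridian coordinates `q = (r, z)`, `r > 0` (Ożański's
`P = {(x₁,x₂) : x₂ > 0}`, §3, with his `x₂ =` distance to the axis `= r`).
[cite: Ozanski2017NSISingular, §3 (opening)] -/
def halfPlane : Set (ℝ × ℝ) :=
  {q | 0 < q.1}

/-- The **solid of revolution** `R(U) = {x ∈ ℝ³ : (cylRadius x, x 2) ∈ U}` of a planar set `U`
(Ożański (3.2): `R(U) = {R_φ(y,0) : φ ∈ [0,2π), y ∈ U}` for `U ⋐ P`; for `U ⊆ P` the two agree,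
the cylindrical projection `R⁻¹ = meridian` (3.3) being a left inverse of the rotation).
[cite: Ozanski2017NSISingular, §3.1 (3.2)–(3.3)] -/
def revolve (U : Set (ℝ × ℝ)) : Set ℝ³ :=
  meridian ⁻¹' U

/-- Membership in a solid of revolution. [folklore] -/
@[simp] theorem mem_revolve {U : Set (ℝ × ℝ)} {x : ℝ³} : x ∈ revolve U ↔ meridian x ∈ U := .rfl

/-- The meridian projection is continuous. [folklore] -/
theorem continuous_meridian : Continuous (meridian : ℝ³ → ℝ × ℝ) :=
  continuous_cylRadius.prodMk (by fun_prop)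

/-- `‖x‖² = r² + z²`: the meridian projection preserves the Euclidean length. [folklore] -/
theorem norm_sq_eq_meridian (x : ℝ³) : ‖x‖ ^ 2 = cylRadius x ^ 2 + (x 2) ^ 2 := by
  rw [EuclideanSpace.norm_eq, Real.sq_sqrt (by positivity), Fin.sum_univ_three, cylRadius_sq]
  simp only [Real.norm_eq_abs, sq_abs]

/-- The solid of revolution of a compact planar set is compact (`G = R(Ū₁ ∪ Ū₂)` is compact).
[cite: Ozanski2017NSISingular, §2 (p. 6) and §4 (4.3)] -/
theorem isCompact_revolve {K : Set (ℝ × ℝ)} (hK : IsCompact K) : IsCompact (revolve K) := by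
  obtain ⟨M, hM⟩ := hK.isBounded.exists_norm_le
  refine Metric.isCompact_of_isClosed_isBounded (hK.isClosed.preimage continuous_meridian) ?_
  rw [isBounded_iff_forall_norm_le]
  refine ⟨M + M, fun x hx => ?_⟩
  have h := hM _ hx
  rw [Prod.norm_def, max_le_iff] at h
  simp only [meridian_apply, Real.norm_eq_abs] at h
  have hM0 : 0 ≤ M := (abs_nonneg _).trans h.1
  have h1 : cylRadius x ≤ M := (le_abs_self _).trans h.1
  have h3 : ‖x‖ ^ 2 ≤ (M + M) ^ 2 := by
    rw [norm_sq_eq_meridian]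
    nlinarith [cylRadius_nonneg x, sq_abs (x 2), abs_nonneg (x 2), h.2]
  exact (pow_le_pow_iff_left₀ (norm_nonneg x) (by positivity) two_ne_zero).1 h3

/-! ### Planar partial derivatives and the operator `L` -/

/-- The radial partial derivative `∂ᵣ g (r, z) = Dg(r,z)(1, 0)` on the meridian plane (Fréchet
derivative; junk `0` where `g` is not differentiable); Ożański's `∂₂`. [folklore] -/
def derivR {F : Type*} [NormedAddCommGroup F] [NormedSpace ℝ F] (g : ℝ × ℝ → F) (q : ℝ × ℝ) : F :=
  fderiv ℝ g q (1, 0)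

/-- The axial partial derivative `∂_z g (r, z) = Dg(r,z)(0, 1)` (Ożański's `∂₁`). [folklore] -/
def derivZ {F : Type*} [NormedAddCommGroup F] [NormedSpace ℝ F] (g : ℝ × ℝ → F) (q : ℝ × ℝ) : F :=
  fderiv ℝ g q (0, 1)

/-- **Scheffer's operator** `Lf = Δf + x₂⁻¹ ∂₂f - x₂⁻² f` (Ożański (3.15); Scheffer 1985, p. 51), in
meridian coordinates `(L f)(r,z) = ∂ᵣ∂ᵣf + ∂_z∂_zf + r⁻¹∂ᵣf - f/r²`; `Δ u[0,f] = (Lf) φ̂` (Lemma 3.1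
(ii)). Junk values on the axis `r = 0` are never met (structures live in `U ⋐ P`).
[cite: Ozanski2017NSISingular, §3.3 (3.15)] -/
def opL (f : ℝ × ℝ → ℝ) (q : ℝ × ℝ) : ℝ :=
  derivR (derivR f) q + derivZ (derivZ f) q + (q.1)⁻¹ * derivR f q - f q / q.1 ^ 2

/-! ### The fields `u[v,f]`, the planar pressure `p[v,f]` and the interaction `F[v,f]` -/

/-- **The axisymmetric field `u[v,f]`** of a planar field `v = (v_r, v_z)` and a scalar `f ≥ |v|`
(Ożański (3.10)/(3.12); Scheffer 1985, p. 51): `u[v,f](x) = v_r(q) ρ̂ + v_z(q) x̂_axis +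
√(f(q)² - |v(q)|²) φ̂`, `q = R⁻¹x = (cylRadius x, x 2)`, in the tree's frame `(eR, eZ, eTheta)`;
`|u[v,f]| = f ∘ R⁻¹` off the axis ((3.11), `norm_swirlField`). On the axis `eR = eTheta = 0` and
`Real.sqrt` of a negative number is `0` (junk values, never met on structures: their data vanish
near `r = 0` and have `f > |v|`). [cite: Ozanski2017NSISingular, §3.3 (3.10)–(3.12)] -/
def swirlField (v : ℝ × ℝ → ℝ × ℝ) (f : ℝ × ℝ → ℝ) (x : ℝ³) : ℝ³ :=
  (v (meridian x)).1 • eR x + (v (meridian x)).2 • eZ +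
    Real.sqrt (f (meridian x) ^ 2 - ((v (meridian x)).1 ^ 2 + (v (meridian x)).2 ^ 2)) • eTheta x

/-- **The planar pressure `p[v,f]`**: the pressure function `p*[v,f] = -Δ⁻¹∂ᵢ∂ⱼ(uᵢuⱼ)`,
`u = u[v,f]` (Ożański (3.19) with (1.1); the tree's `normalisedPressure`, Tao's `p̃`; for the
divergence-free fields of structures the integrand `Σ∂ᵢuⱼ∂ⱼuᵢ` printed in (3.19) is
`∂ᵢ∂ⱼ(uᵢuⱼ)`), restricted to the meridian half-plane: `p[v,f](r,z) = p*[v,f](r, 0, z)` (Ożański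
(3.20): `p[v,f](x₁,x₂) = p*[v,f](x₁,x₂,0)`). [cite: Ozanski2017NSISingular, §3.3 (3.19)–(3.20)] -/
def planePressure (v : ℝ × ℝ → ℝ × ℝ) (f : ℝ × ℝ → ℝ) (q : ℝ × ℝ) : ℝ :=
  normalisedPressure (swirlField v f) (meridianPoint q)

/-- **The pressure interaction function** `F[v,f] = ∇p[0,f] - ∇p[v,f]` (planar gradient, here
the pair `(∂ᵣ, ∂_z)` of Fréchet partials; Ożański (3.34), his components `(F₂, F₁)` in this
order). [cite: Ozanski2017NSISingular, §3.6 (3.34)] -/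
def pressureInteraction (v : ℝ × ℝ → ℝ × ℝ) (f : ℝ × ℝ → ℝ) (q : ℝ × ℝ) : ℝ × ℝ :=
  (derivR (planePressure 0 f) q - derivR (planePressure v f) q,
    derivZ (planePressure 0 f) q - derivZ (planePressure v f) q)

/-- Off the axis the cylindrical frame is orthonormal:
`‖a ρ̂ + b x̂_axis + c φ̂‖² = a² + b² + c²`. [folklore] -/
theorem norm_sq_frame {x : ℝ³} (hx : cylRadius x ≠ 0) (a b c : ℝ) :
    ‖a • eR x + b • eZ + c • eTheta x‖ ^ 2 = a ^ 2 + b ^ 2 + c ^ 2 := by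
  have hr := cylRadius_sq x
  rw [EuclideanSpace.norm_eq, Real.sq_sqrt (by positivity), Fin.sum_univ_three]
  simp only [Real.norm_eq_abs, sq_abs, eR, eTheta, eZ, PiLp.add_apply, PiLp.smul_apply,
    smul_eq_mul, PiLp.single_apply, Matrix.cons_val_zero,
    Matrix.cons_val_one, Matrix.cons_val_two, Matrix.head_cons, Matrix.tail_cons]
  field_simp
  simp
  linear_combination (-(a ^ 2 + c ^ 2)) * hr

/-- **`|u[v,f]| = f`** off the axis, for `f ≥ 0` and `|v| ≤ f` at `R⁻¹x` (Ożański (3.11)).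
[cite: Ozanski2017NSISingular, §3.3 (3.11)] -/
theorem norm_swirlField {v : ℝ × ℝ → ℝ × ℝ} {f : ℝ × ℝ → ℝ} {x : ℝ³} (hx : cylRadius x ≠ 0)
    (hf : 0 ≤ f (meridian x))
    (hvf : (v (meridian x)).1 ^ 2 + (v (meridian x)).2 ^ 2 ≤ f (meridian x) ^ 2) :
    ‖swirlField v f x‖ = f (meridian x) := by
  have h := norm_sq_frame hx (v (meridian x)).1 (v (meridian x)).2
    (Real.sqrt (f (meridian x) ^ 2 - ((v (meridian x)).1 ^ 2 + (v (meridian x)).2 ^ 2)))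
  rw [Real.sq_sqrt (sub_nonneg.2 hvf)] at h
  have h2 : ‖swirlField v f x‖ ^ 2 = f (meridian x) ^ 2 := by rw [swirlField, h]; ring
  exact (sq_eq_sq₀ (norm_nonneg _) hf).1 h2

/-- **`u[v,f]` on the meridian half-plane** (Ożański (3.10):
`u[v,f](x₁,x₂,0) = (v₁, v₂, √(f²-|v|²))`; here, at `(r, 0, z)` with `r > 0`, the components are
`(v_r, √(f² - |v|²), v_z)`). [cite: Ozanski2017NSISingular, §3.3 (3.10)] -/
theorem swirlField_meridianPoint (v : ℝ × ℝ → ℝ × ℝ) (f : ℝ × ℝ → ℝ) {q : ℝ × ℝ}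
    (hq : 0 < q.1) :
    swirlField v f (meridianPoint q) =
      toLp 2 ![(v q).1, Real.sqrt (f q ^ 2 - ((v q).1 ^ 2 + (v q).2 ^ 2)), (v q).2] := by
  have hm : meridian (meridianPoint q) = q := meridian_meridianPoint hq.le
  have hr : cylRadius (meridianPoint q) = q.1 := by
    have := congrArg Prod.fst hm
    simpa using this
  have hq' : q.1 ≠ 0 := hq.ne'
  ext i
  fin_cases i <;>
    simp [swirlField, hr, eR, eTheta, eZ, hq']

/-! ### Structures (Ożański 2017, Definition 3.3) -/

/-- **A structure `(v, f, φ)` on `U ⋐ P`** (Ożański 2017, Definition 3.3, verbatim; Scheffer 1985,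
the hypotheses (3.1)–(3.7) of §3): `U` open with compact closure inside the open half-plane
`P = {r > 0}`; `v ∈ C_c^∞(U; ℝ²)`, `f ∈ C_c^∞(P; [0,∞))`, `φ ∈ C_c^∞(U; [0,1])` (smooth on the
plane, `supp φ ⊆ U`, `supp v ⊆ {φ = 1}` — hence `supp v ⊆ U`, `tsupport_v_subset`), with
`supp f = Ū`, `div(x₂ v) = ∂ᵣ(r v_r) + ∂_z(r v_z) = 0` in `U` (so that `u[v,f]` is divergence
free, Lemma 3.1 (i)), `f > |v|` in `U`, and `Lf > 0` in `U ∖ {φ = 1}`. Euclidean length of `v` is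
written out (`|v|² = v_r² + v_z²`; `ℝ × ℝ` carries the sup norm).
[cite: Ozanski2017NSISingular, Definition 3.3] [cite: Scheffer1985, §3 (3.1)–(3.7)] -/
structure IsNSIStructure (U : Set (ℝ × ℝ)) (v : ℝ × ℝ → ℝ × ℝ) (f φ : ℝ × ℝ → ℝ) : Prop where
  /-- `U` is open, -/
  isOpen : IsOpen U
  /-- relatively compact, -/
  isCompact_closure : IsCompact (closure U)
  /-- in the open half-plane `P` (`U ⋐ P`). -/
  closure_subset : closure U ⊆ halfPlane
  /-- `v` is smooth. -/
  v_smooth : ContDiff ℝ ∞ v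
  /-- `f` is smooth. -/
  f_smooth : ContDiff ℝ ∞ f
  /-- `φ` is smooth. -/
  φ_smooth : ContDiff ℝ ∞ φ
  /-- `f ≥ 0`. -/
  f_nonneg : ∀ q, 0 ≤ f q
  /-- `0 ≤ φ ≤ 1`. -/
  φ_mem : ∀ q, φ q ∈ Icc (0 : ℝ) 1
  /-- `supp f = Ū`. -/
  tsupport_f : tsupport f = closure U
  /-- `φ ∈ C_c^∞(U)`: `supp φ ⊆ U`. -/
  tsupport_φ : tsupport φ ⊆ U
  /-- `supp v ⊆ {φ = 1}`. -/
  tsupport_v : tsupport v ⊆ {q | φ q = 1}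
  /-- `div(x₂ v) = 0` in `U`: `∂ᵣ(r v_r) + ∂_z(r v_z) = 0`. -/
  div_eq_zero : ∀ q ∈ U,
    derivR (fun q' : ℝ × ℝ => q'.1 * (v q').1) q + derivZ (fun q' : ℝ × ℝ => q'.1 * (v q').2) q = 0
  /-- `f > |v|` in `U`. -/
  sq_lt : ∀ q ∈ U, (v q).1 ^ 2 + (v q).2 ^ 2 < f q ^ 2
  /-- `Lf > 0` in `U ∖ {φ = 1}`. -/
  opL_pos : ∀ q ∈ U, φ q ≠ 1 → 0 < opL f q

namespace IsNSIStructure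

variable {U : Set (ℝ × ℝ)} {v : ℝ × ℝ → ℝ × ℝ} {f φ : ℝ × ℝ → ℝ}

/-- `U ⊆ P`. [folklore] -/
theorem subset_halfPlane (h : IsNSIStructure U v f φ) : U ⊆ halfPlane :=
  subset_closure.trans h.closure_subset

/-- `{φ = 1} ⊆ U`. [folklore] -/
theorem setOf_eq_one_subset (h : IsNSIStructure U v f φ) : {q | φ q = 1} ⊆ U := fun q hq =>
  h.tsupport_φ (subset_tsupport _ (by simp [Function.mem_support, (show φ q = 1 from hq)]))

/-- `supp v ⊆ U` (`v ∈ C_c^∞(U; ℝ²)`). [cite: Ozanski2017NSISingular, Definition 3.3] -/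
theorem tsupport_v_subset (h : IsNSIStructure U v f φ) : tsupport v ⊆ U :=
  h.tsupport_v.trans h.setOf_eq_one_subset

/-- `v = 0` off `Ū`. [folklore] -/
theorem v_eq_zero (h : IsNSIStructure U v f φ) {q : ℝ × ℝ} (hq : q ∉ closure U) : v q = 0 :=
  image_eq_zero_of_notMem_tsupport fun hq' => hq (subset_closure (h.tsupport_v_subset hq'))

/-- `f = 0` off `Ū`. [folklore] -/
theorem f_eq_zero (h : IsNSIStructure U v f φ) {q : ℝ × ℝ} (hq : q ∉ closure U) : f q = 0 :=
  image_eq_zero_of_notMem_tsupport fun hq' => hq (h.tsupport_f ▸ hq')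

end IsNSIStructure

/-! ### The geometric arrangement (Ożański 2017, §4, (4.1)–(4.3)) -/

/-- **The geometric arrangement** (Ożański 2017, §4, (4.1)–(4.3); Scheffer 1985, hypotheses
(3.1)–(3.7) of §3): open sets `U₁, U₂ ⋐ P` with structures `(v₁,f₁,φ₁)`, `(v₂,f₂,φ₂)` and
disjoint closures, together with `T > 0`, `τ ∈ (0,1)`, `z ∈ ℝ³` such that, with the pressure
interaction function `F = F[v₁,f₁]` of the first structure,
(4.1) `f₂² + T v₂·F > |v₂|²` in `U₂`, and
(4.2) `f₂(y)² + T v₂(y)·F(y) > τ⁻² (f₁(R⁻¹x) + f₂(R⁻¹x))²` for all `x ∈ G := R(Ū₁ ∪ Ū₂)`,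
where `y = R⁻¹(Γx)`, `Γx = τx + z` (4.3); and `U₁ ≠ ∅` (explicit here, tacit in print, where
`U₁ ⊇ U = (-1,1) × (1/8,7/8)`: the empty pair `U₁ = U₂ = ∅` with zero data would satisfy
(4.1)–(4.2) vacuously and carries no block). Planar inner products are written out.
[cite: Ozanski2017NSISingular, §4 (4.1)–(4.3)] [cite: Scheffer1985, §3 (3.1)–(3.7) and Lemma 6.3] -/
structure IsNSIArrangement (U₁ U₂ : Set (ℝ × ℝ)) (v₁ : ℝ × ℝ → ℝ × ℝ) (f₁ φ₁ : ℝ × ℝ → ℝ)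
    (v₂ : ℝ × ℝ → ℝ × ℝ) (f₂ φ₂ : ℝ × ℝ → ℝ) (T τ : ℝ) (z : ℝ³) : Prop where
  /-- `(v₁, f₁, φ₁)` is a structure on `U₁`. -/
  structure₁ : IsNSIStructure U₁ v₁ f₁ φ₁
  /-- `(v₂, f₂, φ₂)` is a structure on `U₂`. -/
  structure₂ : IsNSIStructure U₂ v₂ f₂ φ₂
  /-- `Ū₁ ∩ Ū₂ = ∅`. -/
  disjoint : Disjoint (closure U₁) (closure U₂)
  /-- `U₁ ≠ ∅` (tacit in print: `U₁ ⊇ U = (-1,1) × (1/8,7/8)`, §5.4). -/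
  nonempty : U₁.Nonempty
  /-- `T > 0`. -/
  T_pos : 0 < T
  /-- `0 < τ < 1`. -/
  τ_mem : τ ∈ Ioo (0 : ℝ) 1
  /-- (4.1): `f₂² + T v₂·F[v₁,f₁] > |v₂|²` in `U₂`. -/
  sq_lt : ∀ q ∈ U₂, (v₂ q).1 ^ 2 + (v₂ q).2 ^ 2 <
    f₂ q ^ 2 + T * ((v₂ q).1 * (pressureInteraction v₁ f₁ q).1 +
      (v₂ q).2 * (pressureInteraction v₁ f₁ q).2)
  /-- (4.2): `f₂(y)² + T v₂(y)·F[v₁,f₁](y) > τ⁻²(f₁(R⁻¹x) + f₂(R⁻¹x))²` for `x ∈ G`,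
  `y = R⁻¹(τx + z)`. -/
  gain : ∀ x ∈ revolve (closure U₁ ∪ closure U₂),
    τ⁻¹ ^ 2 * (f₁ (meridian x) + f₂ (meridian x)) ^ 2 <
      f₂ (meridian (τ • x + z)) ^ 2 +
        T * ((v₂ (meridian (τ • x + z))).1 * (pressureInteraction v₁ f₁ (meridian (τ • x + z))).1 +
          (v₂ (meridian (τ • x + z))).2 * (pressureInteraction v₁ f₁ (meridian (τ • x + z))).2)

namespace IsNSIArrangement

variable {U₁ U₂ : Set (ℝ × ℝ)} {v₁ : ℝ × ℝ → ℝ × ℝ} {f₁ φ₁ : ℝ × ℝ → ℝ} {v₂ : ℝ × ℝ → ℝ × ℝ}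
  {f₂ φ₂ : ℝ × ℝ → ℝ} {T τ : ℝ} {z : ℝ³}

/-- The set `G = R(Ū₁ ∪ Ū₂)` of the arrangement is compact.
[cite: Ozanski2017NSISingular, §4 (4.3)] -/
theorem isCompact_revolve (h : IsNSIArrangement U₁ U₂ v₁ f₁ φ₁ v₂ f₂ φ₂ T τ z) :
    IsCompact (revolve (closure U₁ ∪ closure U₂)) :=
  Literature.Barriers.NavierStokesRegularity.isCompact_revolve
    (h.structure₁.isCompact_closure.union h.structure₂.isCompact_closure)

/-- **`Γ(G) ⊆ R(Ū₂)`** (Ożański §5.4: "`Γ(G) ⊆ R(Ū₂) ⊆ G`", and (4.4): "(4.2) gives in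
particular that `Γ` maps `G` into itself"), from (4.2) alone: at `y = R⁻¹(Γx)`, `x ∈ G`, the
right-hand side of (4.2) is positive, so `f₂(y) ≠ 0` or `v₂(y) ≠ 0`, whence `y ∈ Ū₂`.
[cite: Ozanski2017NSISingular, §4 (4.4) and §5.4] -/
theorem mapsTo_revolve_closure (h : IsNSIArrangement U₁ U₂ v₁ f₁ φ₁ v₂ f₂ φ₂ T τ z) :
    MapsTo (fun x : ℝ³ => τ • x + z) (revolve (closure U₁ ∪ closure U₂))
      (revolve (closure U₂)) := by
  intro x hx
  have hg := h.gain x hx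
  simp only [mem_revolve]
  by_contra hy
  have hf : f₂ (meridian (τ • x + z)) = 0 := h.structure₂.f_eq_zero hy
  have hv : v₂ (meridian (τ • x + z)) = 0 := h.structure₂.v_eq_zero hy
  rw [hf, hv] at hg
  simp only [Prod.fst_zero, Prod.snd_zero, zero_mul, add_zero, mul_zero, ne_eq,
    OfNat.ofNat_ne_zero, not_false_eq_true, zero_pow] at hg
  exact absurd hg (not_lt.2 (by positivity))

/-- **`Γ` maps `G` into itself** (Ożański (4.4)). [cite: Ozanski2017NSISingular, §4 (4.4)] -/
theorem mapsTo (h : IsNSIArrangement U₁ U₂ v₁ f₁ φ₁ v₂ f₂ φ₂ T τ z) :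
    MapsTo (fun x : ℝ³ => τ • x + z) (revolve (closure U₁ ∪ closure U₂))
      (revolve (closure U₁ ∪ closure U₂)) :=
  h.mapsTo_revolve_closure.mono_right (preimage_mono subset_union_right)

/-- `G ≠ ∅`: the meridian points `(r, 0, z)`, `(r, z) ∈ U₁`, lie in `G`. [folklore] -/
theorem nonempty_revolve (h : IsNSIArrangement U₁ U₂ v₁ f₁ φ₁ v₂ f₂ φ₂ T τ z) :
    (revolve (closure U₁ ∪ closure U₂)).Nonempty :=
  let ⟨q, hq⟩ := h.nonempty
  ⟨meridianPoint q, (mem_revolve.2 <| (meridian_meridianPoint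
    (le_of_lt (h.structure₁.subset_halfPlane hq))).symm ▸ Or.inl (subset_closure hq))⟩

end IsNSIArrangement

/-! ### The two named facts and the assembly of `NSIBlockExists` -/

/-- **Fact C — existence of the geometric arrangement** (Ożański 2017, §5: the base structure
`(v,f,φ)` on `U = (-1,1) × (1/8,7/8)` (§3.5, Theorem 3.4), `F = F[v,f]` with the constants
`A, B, C, D, N, κ` of Lemma 3.5, the copies `U^{α,ρ}` (5.12) and the sum `H` (5.13) of three
interaction functions with (i)–(vi) (§5.2), `r = E/ε`, `d = κr`, `v₂` of Lemma 5.2, `τ = 0.48ε`,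
`z = (A, εr/2, 0)` (5.16), the ring `U₂` (5.18), Lemma 5.3, `U₁ = U ∪` three copies (§5.4),
`f₂` with `μ ≥ 100‖f₁‖_∞` (5.30), `T = (μ² - 5)/(1.1ε²B)` (5.31) verify (4.1)–(4.2)
((5.28)–(5.29)); Scheffer 1985, §4 and §6). There exist `U₁, U₂, (v₁,f₁,φ₁), (v₂,f₂,φ₂), T, τ, z`
forming an `IsNSIArrangement`. [cite: Ozanski2017NSISingular, §5 (Lemmas 5.2, 5.3, §5.5)]
[cite: Scheffer1985, §4, §6 (Lemmas 6.1–6.3)] -/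
def NSIArrangementExists : Prop :=
  ∃ (U₁ U₂ : Set (ℝ × ℝ)) (v₁ : ℝ × ℝ → ℝ × ℝ) (f₁ φ₁ : ℝ × ℝ → ℝ) (v₂ : ℝ × ℝ → ℝ × ℝ)
    (f₂ φ₂ : ℝ × ℝ → ℝ) (T τ : ℝ) (z : ℝ³), IsNSIArrangement U₁ U₂ v₁ f₁ φ₁ v₂ f₂ φ₂ T τ z

/-- **Fact D — a block from an arrangement** (Ożański 2017, §4: given the arrangement, choose
`θ` by (4.12), `h₁, h₂` and `δ` by Lemma 4.1 ((4.14)–(4.15)), `ν₀ ∈ (0,1)` by (4.21), and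
`u(x,t) = u[a₁ᵏ(t)v₁, q₁ᵏ_t](x) + u[a₂ᵏ(t)v₂, q₂ᵏ_t](x)` ((4.25)–(4.26)) with the oscillatory
processes of Theorem 4.3, `k` large; Proposition 4.2: `u ∈ C^∞(ℝ³ × (-η, T+η); ℝ³)`, `η ∈ (0,δ)`,
with (i) `supp u(t) = G`, `div u(t) = 0`, (ii) `|u(x,0)| = h₀(R⁻¹x)`,
`||u(x,t)|² - h_t(R⁻¹x)²| < θ`, (iii) the pointwise NSI on `ℝ³ × [0,T]` for all `ν ∈ [0,ν₀]`
with the pressure function of `u`;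
then: "`u` given by the proposition satisfies all the properties required in Section 2" (the
gain (2.2) from (ii) and (4.17); `u(·,0) ≢ 0` as `|u(·,0)| = (f₁ + f₂) ∘ R⁻¹`, `U₁ ≠ ∅`);
Scheffer 1985, Lemmas 3.1–3.3 with 2.1). For every geometric arrangement there are `ν₀`, `u`
with `(T, ν₀, τ, z, G, u)`, `G = R(Ū₁ ∪ Ū₂)`, a classical block (`IsNSIBlock`; its pressure
`normalisedPressure (u t)` is Ożański's (1.1)).
[cite: Ozanski2017NSISingular, §4 (Lemma 4.1, (4.21), Prop. 4.2)]
[cite: Scheffer1985, Lemmas 2.1, 3.1–3.3] -/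
def NSIBlock_of_arrangement : Prop :=
  ∀ (U₁ U₂ : Set (ℝ × ℝ)) (v₁ : ℝ × ℝ → ℝ × ℝ) (f₁ φ₁ : ℝ × ℝ → ℝ) (v₂ : ℝ × ℝ → ℝ × ℝ)
    (f₂ φ₂ : ℝ × ℝ → ℝ) (T τ : ℝ) (z : ℝ³), IsNSIArrangement U₁ U₂ v₁ f₁ φ₁ v₂ f₂ φ₂ T τ z →
    ∃ (ν₀ : ℝ) (u : ℝ → ℝ³ → ℝ³), IsNSIBlock T ν₀ τ z (revolve (closure U₁ ∪ closure U₂)) u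

/-- **Assembly (proved): fact B from facts C and D.** The geometric arrangement of §5 and the
construction of §4 give a classical block, i.e. `NSIBlockExists` (Ożański 2017, §4:
"In this section we define constants `T > 0`, `ν₀ > 0`, `τ ∈ (0,1)`, `z ∈ ℝ³`, the set `G` and
the vector field `u` which were required in the sketch proof in Section 2"; Scheffer 1985, p. 84:
"Theorem 1.1 is a consequence of Lemma 6.4, Lemma 3.3 and Lemma 2.4").
[cite: Ozanski2017NSISingular, §4 (opening paragraph)] -/
theorem nsiBlockExists_of_arrangement (hC : NSIArrangementExists) (hD : NSIBlock_of_arrangement) :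
    NSIBlockExists := by
  obtain ⟨U₁, U₂, v₁, f₁, φ₁, v₂, f₂, φ₂, T, τ, z, h⟩ := hC
  obtain ⟨ν₀, u, hu⟩ := hD U₁ U₂ v₁ f₁ φ₁ v₂ f₂ φ₂ T τ z h
  exact ⟨T, ν₀, τ, z, _, u, hu⟩

end Literature.Barriers.NavierStokesRegularity
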